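import Literature.MathematicalPhysics.QuantumLattice.ChronologicalGramBound
import Literature.Analysis.Matrix.ExpAbsKernel
import HarnessLib

/-!
# The Matsubara-UV determinant bound for time-ordered free fermion propagators
(Pedra–Salmhofer 2008), uniformly in the temperature

Topic `MathematicalPhysics/QuantumLattice`; programme under the tree's fact `bgm_two_point_limit`
(`HubbardFermiLiquid.lean`). The convergence of fermionic perturbation theory at weak coupling
rests on `n!`-free bounds `|det G| ≤ Cⁿ` for the matrices of free TIME-ORDERED propagators
(Benfatto–Giuliani–Mastropietro 2006 (2.80); Salmhofer 1999 Lemmas 7–8). The tree's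
`FermionDeterminantBound.norm_det_timeOrderedPropagator_le_prod_norm_exp` gives such a bound from
the CAR norm, but with factors `e^{|time|·‖h‖}` — useless at low temperature (times range over
`[0, β]`). The sharp remedy is de Siqueira Pedra–Salmhofer, CMP 282 (2008) 797, Thm 2.4 with
Lemma 4.1 and Cor. 4.2: the free covariance `C(τ, E) = -1_{τ>0} e^{-τE} f_β(-E) + 1_{τ≤0} e^{-τE} f_β(E)`
is, energy by energy, a CHRONOLOGICAL combination of two positive definite time kernels
`e^{-|E|·|z - z'|}` of `β`-shifted clocks with weights `≤ 1`, so Thm 1.3 (tree: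
`norm_det_chronological_le`) bounds its determinants by `2ⁿ` per unit smearing, uniformly in `β`,
the energies and the volume ("determinant bound `δ_C = 2 μ(B)^{1/2}`").

This file proves the finite-dimensional (finitely many one-body modes) version in MODE FORM, the
form consumed by determinant/tree expansions (`HubbardDysonDeterminant`, `FermionicTree*`;
interpolation weights `⟨ω_a, ω_b⟩` and sector/cutoff weights are absorbed into the mode data
`F, G` by tensoring):

* `timeKernel_on_eq`, `timeKernel_off_eq` — the four-case rewriting of
  `e^{(s-t)d}/(1+e^{±βd})` as `(1+e^{-β|d|})⁻¹ · e^{-|d|·|z - z'|}` (loc. cit. §4.1);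
* **`norm_det_timeOrdered_modes_le`** — for modes `m` with real energies `d_m`, any `β`,
  creation data `(F_a, s_a ∈ [0,β])`, annihilation data `(G_b, t_b ∈ [0,β])` and a time-consistent
  interleaving pattern `k`,
  `|det [a < k_b ? Σ_m F_a(m)G_b(m) e^{(s_a-t_b)d_m}/(1+e^{βd_m}) : -Σ_m F_a(m)G_b(m) e^{(s_a-t_b)d_m}/(1+e^{-βd_m})]|
     ≤ 2ⁿ ∏_a ‖F_a‖₂ ∏_b ‖G_b‖₂`.

Everything is PROVED; no definition. NOT here: the rewriting of the tree's matrix-valued form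
`[e^{-t_b h}(1+e^{βh})⁻¹e^{s_a h}]_{j_b i_a}` (Hermitian `h`) into mode form (spectral theorem), and
the decay ("`α`") constants / convergence theorems of loc. cit. §4.2–§5.

## References

* W. de Siqueira Pedra, M. Salmhofer, *Determinant bounds and the Matsubara UV problem of
  many-fermion systems*, Comm. Math. Phys. 282 (2008) 797–818, Thm 2.4, Lemma 4.1, Cor. 4.2.
  [PedraSalmhofer2008]
* G. Benfatto, A. Giuliani, V. Mastropietro, Ann. Henri Poincaré 7 (2006) 809–898, §2.8 (2.80).
  [BenfattoGiulianiMastropietro2006]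
-/

noncomputable section

open scoped Matrix ComplexOrder
open Finset NormedSpace Literature.Analysis.Matrix

namespace Literature.MathematicalPhysics.QuantumLattice

/-! ### The four time kernels of the free propagator (Pedra–Salmhofer Lemma 4.1) -/

/-- Cross-multiplication: `x z = w y` with `y, z ≠ 0` gives `x y⁻¹ = z⁻¹ w`. [folklore] -/
theorem mul_inv_eq_inv_mul_of_cross {x y z w : ℝ} (hy : y ≠ 0) (hz : z ≠ 0) (h : x * z = w * y) :
    x * y⁻¹ = z⁻¹ * w := by
  rw [mul_inv_eq_iff_eq_mul₀ hy, inv_mul_eq_div, div_mul_eq_mul_div, eq_div_iff hz, h]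

/-- ON the pattern (creation to the left, `Δ = s - t ≥ 0`, `s ≤ β`, `0 ≤ t`):
`e^{Δ d}/(1 + e^{β d}) = w · e^{-|d|·|(s - [d>0]β) - t|}` with `w = (1 + e^{-β|d|})⁻¹`.
[cite: PedraSalmhofer2008, §4.1 (four-case formula before Lemma 4.1)] -/
theorem timeKernel_on_eq (d β s t : ℝ) (hst : t ≤ s) (hs : s ≤ β) (ht : 0 ≤ t) :
    Real.exp ((s - t) * d) * (1 + Real.exp (β * d))⁻¹ =
      (1 + Real.exp (-(β * |d|)))⁻¹ *
        Real.exp (-(|d| * |(s - (if 0 < d then β else 0)) - t|)) := by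
  by_cases hd : 0 < d
  · rw [if_pos hd, abs_of_pos hd, abs_of_nonpos (by linarith : s - β - t ≤ 0)]
    refine mul_inv_eq_inv_mul_of_cross (by positivity) (by positivity) ?_
    simp only [mul_add, mul_one, ← Real.exp_add]
    ring_nf
  · rw [if_neg hd, abs_of_nonpos (not_lt.mp hd), sub_zero, abs_of_nonneg (by linarith : 0 ≤ s - t),
      mul_comm (Real.exp ((s - t) * d))]
    congr 1
    · rw [show -(β * -d) = β * d by ring]
    · rw [show -(-d * (s - t)) = (s - t) * d by ring]

/-- OFF the pattern (annihilation to the left, `Δ = s - t ≤ 0`, `0 ≤ s`, `t ≤ β`):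
`e^{Δ d}/(1 + e^{-β d}) = w · e^{-|d|·|s - (t - [d<0]β)|}` with `w = (1 + e^{-β|d|})⁻¹`.
[cite: PedraSalmhofer2008, §4.1 (four-case formula before Lemma 4.1)] -/
theorem timeKernel_off_eq (d β s t : ℝ) (hst : s ≤ t) (hs : 0 ≤ s) (ht : t ≤ β) :
    Real.exp ((s - t) * d) * (1 + Real.exp (-(β * d)))⁻¹ =
      (1 + Real.exp (-(β * |d|)))⁻¹ *
        Real.exp (-(|d| * |s - (t - (if d < 0 then β else 0))|)) := by
  by_cases hd : d < 0
  · rw [if_pos hd, abs_of_neg hd, abs_of_nonneg (by linarith : 0 ≤ s - (t - β))]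
    refine mul_inv_eq_inv_mul_of_cross (by positivity) (by positivity) ?_
    simp only [mul_add, mul_one, ← Real.exp_add]
    ring_nf
  · rw [if_neg hd, abs_of_nonneg (not_lt.mp hd), sub_zero, abs_of_nonpos (by linarith : s - t ≤ 0),
      mul_comm (Real.exp ((s - t) * d))]
    congr 2
    rw [show -(d * -(s - t)) = (s - t) * d by ring]

/-! ### The determinant bound, mode form -/

/-- **Pedra–Salmhofer's determinant bound for the time-ordered free propagator — mode form**
(de Siqueira Pedra–Salmhofer 2008, Thm 2.4 / Lemma 4.1 / Cor. 4.2, finite-dimensional version).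
One-body modes `m` with real energies `d_m`, inverse temperature `β`, creation data
(`F_a`, time `s_a ∈ [0, β]`), annihilation data (`G_b`, time `t_b ∈ [0, β]`), and a
time-consistent interleaving pattern `k` (creation `a` LEFT of annihilation `b` iff `a < k_b`, and
then `t_b ≤ s_a`; otherwise `s_a ≤ t_b`). The matrix of free time-ordered contractions
`a < k_b ? Σ_m F_a(m) G_b(m) e^{(s_a-t_b)d_m}/(1+e^{βd_m}) : -Σ_m F_a(m) G_b(m) e^{(s_a-t_b)d_m}/(1+e^{-βd_m})`
satisfies `|det| ≤ 2ⁿ ∏_a ‖F_a‖₂ ∏_b ‖G_b‖₂` — UNIFORMLY in `β`, the energies and the number of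
modes (no `e^{β‖h‖}`, no `n!`). Proof: each branch is, mode by mode, the weight
`w_m = (1+e^{-β|d_m|})⁻¹ ≤ 1` times the positive definite time kernel `e^{-|d_m|·|z - z'|}` of
suitably `β`-shifted clocks (`timeKernel_on_eq`, `timeKernel_off_eq`); unit Gram vectors for the
latter (`IsPosDefKernel.exists_gram_vectors`) make both branches Gram kernels with row/column
norms `≤ ‖F_a‖, ‖G_b‖`, and `norm_det_chronological_le` gives `∏ √(2‖F_a‖²) √(2‖G_b‖²)`.
[cite: PedraSalmhofer2008, Thm 2.4 and Lemma 4.1] -/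
theorem norm_det_timeOrdered_modes_le {μ : Type*} [Fintype μ] (d : μ → ℝ) (β : ℝ)
    {n : ℕ} (F G : Fin n → μ → ℂ) (s t : Fin n → ℝ)
    (hs : ∀ a, 0 ≤ s a ∧ s a ≤ β) (ht : ∀ b, 0 ≤ t b ∧ t b ≤ β)
    (k : Fin n → ℕ) (hk : Monotone k) (hkn : ∀ b, k b ≤ n)
    (hcons : ∀ a b : Fin n, ((a : ℕ) < k b → t b ≤ s a) ∧ (¬ (a : ℕ) < k b → s a ≤ t b)) :
    ‖(Matrix.of fun a b : Fin n =>
        if (a : ℕ) < k b then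
          ∑ m, F a m * G b m *
            ((Real.exp ((s a - t b) * d m) * (1 + Real.exp (β * d m))⁻¹ : ℝ) : ℂ)
        else -∑ m, F a m * G b m *
            ((Real.exp ((s a - t b) * d m) * (1 + Real.exp (-(β * d m)))⁻¹ : ℝ) : ℂ)).det‖ ≤
      2 ^ n * ((∏ a, Real.sqrt (∑ m, ‖F a m‖ ^ 2)) * ∏ b, Real.sqrt (∑ m, ‖G b m‖ ^ 2)) := by
  classical
  -- weights
  set w : μ → ℝ := fun m => (1 + Real.exp (-(β * |d m|)))⁻¹ with hw
  have hw0 : ∀ m, 0 ≤ w m := fun m => by positivity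
  have hw1 : ∀ m, w m ≤ 1 := fun m => by
    simp only [hw]
    apply inv_le_one_of_one_le₀
    linarith [Real.exp_pos (-(β * |d m|))]
  have hsqw : ∀ m, ((Real.sqrt (w m) : ℝ) : ℂ) * (Real.sqrt (w m) : ℂ) = (w m : ℂ) := fun m => by
    rw [← Complex.ofReal_mul, Real.mul_self_sqrt (hw0 m)]
  -- clocks
  set z₁ : μ → (Fin n ⊕ Fin n) → ℝ :=
    fun m => Sum.elim (fun a => s a - if 0 < d m then β else 0) t with hz₁
  set z₂ : μ → (Fin n ⊕ Fin n) → ℝ :=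
    fun m => Sum.elim s (fun b => t b - if d m < 0 then β else 0) with hz₂
  -- unit Gram vectors of the time kernels, mode by mode
  have hV : ∀ (m : μ) (z : (Fin n ⊕ Fin n) → ℝ), ∃ V : (Fin n ⊕ Fin n) → (Fin n ⊕ Fin n) → ℂ,
      (∀ a b, ∑ r, star (V a r) * V b r = (Real.exp (-(|d m| * |z a - z b|)) : ℂ)) ∧
        ∀ a, ∑ r, ‖V a r‖ ^ 2 = 1 := fun m z =>
    (isPosDefKernel_exp_neg_mul_abs_sub (abs_nonneg (d m))).exists_gram_vectors
      (fun y => by simp) z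
  choose V₁ hV₁ hV₁n using fun m => hV m (z₁ m)
  choose V₂ hV₂ hV₂n using fun m => hV m (z₂ m)
  -- coordinates for `norm_det_chronological_le`
  set u : Fin n → (μ × (Fin n ⊕ Fin n)) → ℂ :=
    fun a x => F a x.1 * (Real.sqrt (w x.1) : ℂ) * star (V₁ x.1 (Sum.inl a) x.2) with hu
  set v : Fin n → (μ × (Fin n ⊕ Fin n)) → ℂ :=
    fun b x => G b x.1 * (Real.sqrt (w x.1) : ℂ) * V₁ x.1 (Sum.inr b) x.2 with hv
  set p : Fin n → (μ × (Fin n ⊕ Fin n)) → ℂ :=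
    fun a x => F a x.1 * (Real.sqrt (w x.1) : ℂ) * star (V₂ x.1 (Sum.inl a) x.2) with hp
  set q : Fin n → (μ × (Fin n ⊕ Fin n)) → ℂ :=
    fun b x => -(G b x.1 * (Real.sqrt (w x.1) : ℂ) * V₂ x.1 (Sum.inr b) x.2) with hq
  -- the entries ON the pattern
  have hon : ∀ a b : Fin n, (a : ℕ) < k b → ∑ x, u a x * v b x =
      ∑ m, F a m * G b m *
        ((Real.exp ((s a - t b) * d m) * (1 + Real.exp (β * d m))⁻¹ : ℝ) : ℂ) := by
    intro a b hab
    have htsa : t b ≤ s a := (hcons a b).1 hab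
    rw [Fintype.sum_prod_type]
    refine Finset.sum_congr rfl fun m _ => ?_
    have e1 : ∀ r, u a (m, r) * v b (m, r) = F a m * G b m * (w m : ℂ) *
        (star (V₁ m (Sum.inl a) r) * V₁ m (Sum.inr b) r) := by
      intro r
      simp only [hu, hv]
      rw [← hsqw m]
      ring
    simp_rw [e1]
    rw [← Finset.mul_sum, hV₁ m, timeKernel_on_eq (d m) β (s a) (t b) htsa (hs a).2 (ht b).1]
    simp only [hz₁, Sum.elim_inl, Sum.elim_inr, hw]
    push_cast
    ring_nf
  -- the entries OFF the pattern
  have hoff : ∀ a b : Fin n, ¬ (a : ℕ) < k b → ∑ x, p a x * q b x =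
      -∑ m, F a m * G b m *
        ((Real.exp ((s a - t b) * d m) * (1 + Real.exp (-(β * d m)))⁻¹ : ℝ) : ℂ) := by
    intro a b hab
    have hsat : s a ≤ t b := (hcons a b).2 hab
    rw [Fintype.sum_prod_type, ← Finset.sum_neg_distrib]
    refine Finset.sum_congr rfl fun m _ => ?_
    have e1 : ∀ r, p a (m, r) * q b (m, r) = -(F a m * G b m * (w m : ℂ) *
        (star (V₂ m (Sum.inl a) r) * V₂ m (Sum.inr b) r)) := by
      intro r
      simp only [hp, hq]
      rw [← hsqw m]
      ring
    simp_rw [e1]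
    rw [Finset.sum_neg_distrib, ← Finset.mul_sum, hV₂ m,
      timeKernel_off_eq (d m) β (s a) (t b) hsat (hs a).1 (ht b).2]
    simp only [hz₂, Sum.elim_inl, Sum.elim_inr, hw]
    push_cast
    ring_nf
  -- the realisation
  have hM : (Matrix.of fun a b : Fin n =>
        if (a : ℕ) < k b then
          ∑ m, F a m * G b m *
            ((Real.exp ((s a - t b) * d m) * (1 + Real.exp (β * d m))⁻¹ : ℝ) : ℂ)
        else -∑ m, F a m * G b m *
            ((Real.exp ((s a - t b) * d m) * (1 + Real.exp (-(β * d m)))⁻¹ : ℝ) : ℂ)) =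
      Matrix.of fun a b : Fin n =>
        if (a : ℕ) < k b then ∑ x, u a x * v b x else ∑ x, p a x * q b x := by
    ext a b
    simp only [Matrix.of_apply]
    split_ifs with hab
    · rw [hon a b hab]
    · rw [hoff a b hab]
  rw [hM]
  refine (norm_det_chronological_le u v p q k hk hkn).trans ?_
  -- norms of the coordinates
  have hnu : ∀ a, ∑ x, ‖u a x‖ ^ 2 ≤ ∑ m, ‖F a m‖ ^ 2 := by
    intro a
    rw [Fintype.sum_prod_type]
    refine Finset.sum_le_sum fun m _ => ?_
    have e1 : ∀ r, ‖u a (m, r)‖ ^ 2 = ‖F a m‖ ^ 2 * w m * ‖V₁ m (Sum.inl a) r‖ ^ 2 := by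
      intro r
      simp only [hu, norm_mul, norm_star, Complex.norm_real, Real.norm_eq_abs,
        abs_of_nonneg (Real.sqrt_nonneg _), mul_pow, Real.sq_sqrt (hw0 m)]
    simp_rw [e1]
    rw [← Finset.mul_sum, hV₁n m, mul_one]
    exact mul_le_of_le_one_right (by positivity) (hw1 m)
  have hnp : ∀ a, ∑ x, ‖p a x‖ ^ 2 ≤ ∑ m, ‖F a m‖ ^ 2 := by
    intro a
    rw [Fintype.sum_prod_type]
    refine Finset.sum_le_sum fun m _ => ?_
    have e1 : ∀ r, ‖p a (m, r)‖ ^ 2 = ‖F a m‖ ^ 2 * w m * ‖V₂ m (Sum.inl a) r‖ ^ 2 := by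
      intro r
      simp only [hp, norm_mul, norm_star, Complex.norm_real, Real.norm_eq_abs,
        abs_of_nonneg (Real.sqrt_nonneg _), mul_pow, Real.sq_sqrt (hw0 m)]
    simp_rw [e1]
    rw [← Finset.mul_sum, hV₂n m, mul_one]
    exact mul_le_of_le_one_right (by positivity) (hw1 m)
  have hnv : ∀ b, ∑ x, ‖v b x‖ ^ 2 ≤ ∑ m, ‖G b m‖ ^ 2 := by
    intro b
    rw [Fintype.sum_prod_type]
    refine Finset.sum_le_sum fun m _ => ?_
    have e1 : ∀ r, ‖v b (m, r)‖ ^ 2 = ‖G b m‖ ^ 2 * w m * ‖V₁ m (Sum.inr b) r‖ ^ 2 := by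
      intro r
      simp only [hv, norm_mul, Complex.norm_real, Real.norm_eq_abs,
        abs_of_nonneg (Real.sqrt_nonneg _), mul_pow, Real.sq_sqrt (hw0 m)]
    simp_rw [e1]
    rw [← Finset.mul_sum, hV₁n m, mul_one]
    exact mul_le_of_le_one_right (by positivity) (hw1 m)
  have hnq : ∀ b, ∑ x, ‖q b x‖ ^ 2 ≤ ∑ m, ‖G b m‖ ^ 2 := by
    intro b
    rw [Fintype.sum_prod_type]
    refine Finset.sum_le_sum fun m _ => ?_
    have e1 : ∀ r, ‖q b (m, r)‖ ^ 2 = ‖G b m‖ ^ 2 * w m * ‖V₂ m (Sum.inr b) r‖ ^ 2 := by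
      intro r
      simp only [hq, norm_neg, norm_mul, Complex.norm_real, Real.norm_eq_abs,
        abs_of_nonneg (Real.sqrt_nonneg _), mul_pow, Real.sq_sqrt (hw0 m)]
    simp_rw [e1]
    rw [← Finset.mul_sum, hV₂n m, mul_one]
    exact mul_le_of_le_one_right (by positivity) (hw1 m)
  -- assemble: `∏ √(‖u‖²+‖p‖²) ≤ (√2)ⁿ ∏ ‖F_a‖`, same for columns
  have hrow : (∏ a, Real.sqrt (∑ x, ‖u a x‖ ^ 2 + ∑ x, ‖p a x‖ ^ 2)) ≤
      (Real.sqrt 2) ^ n * ∏ a, Real.sqrt (∑ m, ‖F a m‖ ^ 2) := by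
    have : (Real.sqrt 2) ^ n * ∏ a, Real.sqrt (∑ m, ‖F a m‖ ^ 2) =
        ∏ a : Fin n, (Real.sqrt 2 * Real.sqrt (∑ m, ‖F a m‖ ^ 2)) := by
      rw [Finset.prod_mul_distrib, Finset.prod_const, Finset.card_univ, Fintype.card_fin]
    rw [this]
    refine Finset.prod_le_prod (fun a _ => Real.sqrt_nonneg _) fun a _ => ?_
    rw [← Real.sqrt_mul (by norm_num : (0 : ℝ) ≤ 2)]
    exact Real.sqrt_le_sqrt (by linarith [hnu a, hnp a])
  have hcol : (∏ b, Real.sqrt (∑ x, ‖v b x‖ ^ 2 + ∑ x, ‖q b x‖ ^ 2)) ≤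
      (Real.sqrt 2) ^ n * ∏ b, Real.sqrt (∑ m, ‖G b m‖ ^ 2) := by
    have : (Real.sqrt 2) ^ n * ∏ b, Real.sqrt (∑ m, ‖G b m‖ ^ 2) =
        ∏ b : Fin n, (Real.sqrt 2 * Real.sqrt (∑ m, ‖G b m‖ ^ 2)) := by
      rw [Finset.prod_mul_distrib, Finset.prod_const, Finset.card_univ, Fintype.card_fin]
    rw [this]
    refine Finset.prod_le_prod (fun b _ => Real.sqrt_nonneg _) fun b _ => ?_
    rw [← Real.sqrt_mul (by norm_num : (0 : ℝ) ≤ 2)]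
    exact Real.sqrt_le_sqrt (by linarith [hnv b, hnq b])
  have h2n : (Real.sqrt 2) ^ n * (Real.sqrt 2) ^ n = 2 ^ n := by
    rw [← mul_pow, Real.mul_self_sqrt (by norm_num : (0 : ℝ) ≤ 2)]
  have hR0 : 0 ≤ (Real.sqrt 2) ^ n * ∏ a, Real.sqrt (∑ m, ‖F a m‖ ^ 2) := by positivity
  have hcol0 : 0 ≤ ∏ b, Real.sqrt (∑ x, ‖v b x‖ ^ 2 + ∑ x, ‖q b x‖ ^ 2) :=
    Finset.prod_nonneg fun b _ => Real.sqrt_nonneg _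
  calc (∏ a, Real.sqrt (∑ x, ‖u a x‖ ^ 2 + ∑ x, ‖p a x‖ ^ 2)) *
        ∏ b, Real.sqrt (∑ x, ‖v b x‖ ^ 2 + ∑ x, ‖q b x‖ ^ 2)
      ≤ ((Real.sqrt 2) ^ n * ∏ a, Real.sqrt (∑ m, ‖F a m‖ ^ 2)) *
          ((Real.sqrt 2) ^ n * ∏ b, Real.sqrt (∑ m, ‖G b m‖ ^ 2)) := mul_le_mul hrow hcol hcol0 hR0
    _ = 2 ^ n * ((∏ a, Real.sqrt (∑ m, ‖F a m‖ ^ 2)) * ∏ b, Real.sqrt (∑ m, ‖G b m‖ ^ 2)) := by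
        rw [← h2n]; ring

end Literature.MathematicalPhysics.QuantumLattice
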